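import Literature.NumberTheory.EllipticCurves.TakahashiDegreeFormulaCoprimeProofs
import Literature.NumberTheory.EllipticCurves.EichlerSelbergTraceWeightTwoSquarefree
import Literature.NumberTheory.EllipticCurves.TakahashiRankOneOfEichlerSelberg
import HarnessLib

/-!
# Stub ideas k3, generation 3 (FAMILY 3 — PROBE THE EXTREMES) for `stub_takahashi`
# (`takahashi2001_thm_2_3_of_coprime`), crux `DefiniteRTControlPrime`, route `DefiniteXi`

Scratch sketch of the ideator (elaboration sanity only; `sorry` allowed in helper statements;
not a proposal, not a skeleton edit).  Companion of `STUB-IDEAS-stub_takahashi-3.md` (gen 3).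

* §T4 — the GL₂ Eichler–Selberg input at the Frey levels `N = 2^e · m` (the last provable debt of
  the depth path `stub ⇐ rank one ∧ T♭`): seam census of the tree's squarefree proof and the
  CUSP-SIMPLE regime `e ≤ 3`, with the new prime-power local lemma
  `fixCount (ℓ^e) M = μ_{ℓ^e}(t, f, n)` (TERMWISE — numerically certified in this session).
* §T5 — the extremal split of the geometric residue T♭ by provenance: the SQUARE LAW
  `δ' · c_r(W') = m'² · ξ` for EVERY parametrised curve of conductor `M r` (functorial half, no
  optimality) versus the optimal-index identity `m · i₀ = c_r` (optimal half).
-/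

noncomputable section

open scoped BigOperators Matrix
open Finset

namespace Summit.ABC.ABC.Cruxes.DefiniteRTControlPrime.StubIdeas3g3

open Literature.NumberTheory.EllipticCurves Literature.NumberTheory.EllipticCurves.ModularForms
open Literature.NumberTheory.Automorphic Literature.NumberTheory.Automorphic.Brandt
open Literature.NumberTheory.Automorphic.HeckeTraceFormulaGL2Level

/-! ## §T4 — GL₂ side at the Frey levels `N = 2^e · m`: the cusp-simple regime `e ≤ 3` -/

/-- `N` is **cusp-simple**: `gcd(c, N/c) ∣ 2` for every `c ∣ N` (⇔ `ord₂ N ≤ 3` and the odd part of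
`N` squarefree).  Then `φ(gcd(c, N/c)) = 1` for all `c ∣ N`: cusps ↔ divisors, there is no primitive
Dirichlet character `ψ` with `cond(ψ)² ∣ N`, so every Hecke eigenvalue of `T_p` (`p ∤ N`) on the
Eisenstein space `E₂(Γ₀(N))` is `1 + p` — the three places where `Squarefree N` enters Popa's
boundary step survive verbatim. -/
def CuspSimple (N : ℕ) : Prop := ∀ c ∈ N.divisors, Nat.gcd c (N / c) ∣ 2

instance (N : ℕ) : Decidable (CuspSimple N) := by unfold CuspSimple; infer_instance

/-- The Frey levels of regime A are cusp-simple; `16 ∣ N` is not (sanity, kernel-checked). -/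
example : CuspSimple 24 ∧ CuspSimple 40 ∧ CuspSimple 120 ∧ ¬ CuspSimple 48 ∧ ¬ CuspSimple 18 := by decide

/-- H4.0a (XS): squarefree ⇒ cusp-simple (`gcd_div_eq_one_of_squarefree`). -/
theorem cuspSimple_of_squarefree {N : ℕ} (hN : Squarefree N) : CuspSimple N := by
  intro c hc
  rw [gcd_div_eq_one_of_squarefree hN hc]
  exact one_dvd _

/-- H4.0b (S): `2^e · m`, `e ≤ 3`, `m` odd squarefree, is cusp-simple. -/
theorem cuspSimple_two_pow_mul {e m : ℕ} (he : e ≤ 3) (hm : Squarefree m) (hmo : Odd m) :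
    CuspSimple (2 ^ e * m) := by
  sorry

/-- H4.0c (S): under cusp-simplicity every `φ(gcd(c, N/c))` is `1`. -/
theorem totient_gcd_div_eq_one_of_cuspSimple {N : ℕ} (hN : CuspSimple N) {c : ℕ} (hc : c ∈ N.divisors) :
    Nat.totient (Nat.gcd c (N / c)) = 1 := by
  rcases (Nat.dvd_prime Nat.prime_two).mp (hN c hc) with h | h
  · rw [h, Nat.totient_one]
  · rw [h, Nat.totient_two]

/-- H4.6a (S): the cusp count at cusp-simple level is the divisor count
(`numCusps_eq_nuInfty_holds` + H4.0c; replaces `numCusps_squarefree`). -/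
theorem numCusps_of_cuspSimple {N : ℕ} [NeZero N] (hN : CuspSimple N) : numCusps N = N.divisors.card := by
  rw [show numCusps N = nuInfty N from numCusps_eq_nuInfty_holds N, nuInfty, Finset.card_eq_sum_ones]
  exact Finset.sum_congr rfl fun d hd => by rw [totient_gcd_div_eq_one_of_cuspSimple hN hd]

/-- H4.6b (S): the hyperbolic term `A₃` at cusp-simple level, `(n, N) = 1`: the divisibility
`gcd(c, N/c) ∣ n/d − d` of `hyperbolicTerm_one_two_of_coprime` is automatic (`gcd ∈ {1, 2}`, and for
even `N` the integer `n` is odd, so `d`, `n/d` are odd) — replaces `hyperbolicTerm_one_two_squarefree`. -/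
theorem hyperbolicTerm_one_two_of_cuspSimple {N : ℕ} [NeZero N] (hN : CuspSimple N) {n : ℕ}
    (hnN : n.Coprime N) :
    hyperbolicTerm N 1 2 n = -((N.divisors.card : ℂ) *
      ∑ d ∈ n.divisors.filter (fun d => d * d ≤ n), (if d * d = n then (1 / 2 : ℂ) else 1) * (d : ℂ)) := by
  rw [hyperbolicTerm_one_two_of_coprime N hnN, Finset.mul_sum]
  congr 1
  refine Finset.sum_congr rfl fun d hd => ?_
  have hdn : d ∣ n := Nat.dvd_of_mem_divisors (Finset.mem_filter.mp hd).1
  have hdpos : 0 < d := Nat.pos_of_mem_divisors (Finset.mem_filter.mp hd).1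
  have hdvd : ∀ c ∈ N.divisors, (Nat.gcd c (N / c) : ℤ) ∣ ((n / d : ℕ) : ℤ) - d := by
    intro c hc
    rcases (Nat.dvd_prime Nat.prime_two).mp (hN c hc) with h | h
    · rw [h]; simp
    · have h2N : 2 ∣ N := by
        have hg : Nat.gcd c (N / c) ∣ c := Nat.gcd_dvd_left _ _
        rw [h] at hg
        exact hg.trans (Nat.dvd_of_mem_divisors hc)
      have hn2 : ¬ 2 ∣ n := fun h2n =>
        absurd (Nat.eq_one_of_dvd_one (hnN ▸ Nat.dvd_gcd h2n h2N)) (by norm_num)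
      obtain ⟨k, hk⟩ := hdn
      have hnd : n / d = k := by rw [hk, Nat.mul_div_cancel_left k hdpos]
      have hd2 : ¬ 2 ∣ d := fun h' => hn2 (hk ▸ dvd_mul_of_dvd_left h' k)
      have hk2 : ¬ 2 ∣ k := fun h' => hn2 (hk ▸ dvd_mul_of_dvd_right h' d)
      rw [h, hnd]
      push_cast
      omega
  have hinner : (∑ c ∈ N.divisors.filter (fun c => (Nat.gcd c (N / c) : ℤ) ∣ ((n / d : ℕ) : ℤ) - d),
      (Nat.totient (Nat.gcd c (N / c)) : ℂ)) = (N.divisors.card : ℂ) := by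
    rw [Finset.filter_true_of_mem hdvd, Finset.card_eq_sum_ones, Nat.cast_sum]
    exact Finset.sum_congr rfl fun c hc => by rw [totient_gcd_div_eq_one_of_cuspSimple hN hc]
  rw [hinner]
  ring

/-- H4.1 (S): **CRT multiplicativity of the fixed-point count** on `SL₂(ℤ)/Γ₀(N₁N₂)`, from the tree's
`eigPairs_zmod_mul`, `totient_mul_fixCount` (both general level) and `Nat.totient_mul`. -/
theorem fixCount_mul_of_coprime {N₁ N₂ : ℕ} [NeZero N₁] [NeZero N₂] [NeZero (N₁ * N₂)]
    (h : N₁.Coprime N₂) (M : Matrix (Fin 2) (Fin 2) ℤ) (hM : IsCoprime M.det ((N₁ * N₂ : ℕ) : ℤ)) :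
    fixCount (N₁ * N₂) M = fixCount N₁ M * fixCount N₂ M := by
  have hM' : IsCoprime M.det ((N₁ : ℤ) * N₂) := by simpa [Nat.cast_mul] using hM
  have hu : ∀ (K : ℕ) [NeZero K], IsCoprime M.det (K : ℤ) → IsUnit (redMat K M).det := fun K _ hK => by
    rw [isUnit_det_redMat_iff]
    exact (ZMod.coe_int_isUnit_iff_isCoprime _ _).mpr hK.symm
  have e12 := totient_mul_fixCount (hu (N₁ * N₂) hM)
  have e1 := totient_mul_fixCount (hu N₁ hM'.of_mul_right_left)
  have e2 := totient_mul_fixCount (hu N₂ hM'.of_mul_right_right)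
  have key : (N₁ * N₂).totient * fixCount (N₁ * N₂) M =
      (N₁.totient * fixCount N₁ M) * (N₂.totient * fixCount N₂ M) := by
    rw [e12, e1, e2]
    exact eigPairs_zmod_mul h M
  rw [Nat.totient_mul h] at key
  have hpos : 0 < N₁.totient * N₂.totient :=
    Nat.mul_pos (Nat.totient_pos.mpr (NeZero.pos N₁)) (Nat.totient_pos.mpr (NeZero.pos N₂))
  apply Nat.eq_of_mul_eq_mul_left hpos
  rw [key]
  ring

/-- The content of the fixed-point form `Q_M = (c, d − a, −b)` of `M = (a b; c d)`. -/
def fixFormContent (M : Matrix (Fin 2) (Fin 2) ℤ) : ℕ :=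
  Int.gcd (Int.gcd (M 1 0) (M 1 1 - M 0 0)) (M 0 1)

/-- H4.3 (M) — **THE NEW LOCAL LEMMA (prime-power fixed-point count = Cohen–Oesterlé density,
TERMWISE)**: for a prime `ℓ ∤ n = det M`, `t = tr M`, `t² < 4n`, and a conductor `f` whose `ℓ`-part
agrees with that of the content of `Q_M` up to `ℓ^e`,
`Fix_{ℓ^e}(M) = μ_{ℓ^e}(t, f, n) = ψ(ℓ^e)/ψ(ℓ^{e−v}) · #{x mod ℓ^e : x² − tx + n ≡ 0 (ℓ^{e+v})}`,
`v = min(e, v_ℓ f)`.  The case `e = 1` is the tree's `fixCount_eq_rootCount_mul_contFactor` +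
`localDensity_one_prime`.  Certified numerically here: every elliptic integer matrix with entries
`≤ 6` at `ℓ^e ∈ {2,4,8,16,32; 3,9,27; 5,25}` (14 190 matrix checks, 0 mismatches), and the closed
form in `(t, n, f)` for all `t² < 4n ≤ 240` incl. genus-independence of the local zero count
(`compute/gl2_fix_direct.py`, `compute/gl2_local_termwise.py`).  Proof shape: lift the affine chart
argument of `affFix_eq` (`Y = c u + d`) from `𝔽_ℓ` to `ℤ/ℓ^{e+v}`. -/
theorem fixCount_primePow_eq_localDensity {ℓ e : ℕ} (hℓ : ℓ.Prime) (he : 1 ≤ e) [NeZero (ℓ ^ e)]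
    (M : Matrix (Fin 2) (Fin 2) ℤ) {n : ℕ} (hdet : M.det = n) (hn : n.Coprime ℓ)
    (hell : (M 0 0 + M 1 1) ^ 2 < 4 * (n : ℤ)) {f : ℕ}
    (hf : f ∈ ellipticConductors (M 0 0 + M 1 1) n)
    (hcont : min e ((fixFormContent M).factorization ℓ) = min e (f.factorization ℓ)) :
    (fixCount (ℓ ^ e) M : ℂ) = localDensity (ℓ ^ e) 1 (M 0 0 + M 1 1) f n := by
  sorry

/-- H4.4 (S, assembly of H4.1 + H4.3 + the tree's `localDensity_one_mul`): the fixed-point count at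
ANY level prime to `n` is the Cohen–Oesterlé density (so `Fix_N(M)` depends on `M` only through
`(t, n, gcd(N^∞, content))` — the class-independence Popa's regrouping `finsum_bw_wE_fixCount` needs). -/
theorem fixCount_eq_localDensity {N : ℕ} [NeZero N] (M : Matrix (Fin 2) (Fin 2) ℤ) {n : ℕ}
    (hdet : M.det = n) (hnN : n.Coprime N) (hell : (M 0 0 + M 1 1) ^ 2 < 4 * (n : ℤ)) {f : ℕ}
    (hf : f ∈ ellipticConductors (M 0 0 + M 1 1) n)
    (hcont : ∀ ℓ ∈ N.primeFactors, min (N.factorization ℓ) ((fixFormContent M).factorization ℓ) =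
      min (N.factorization ℓ) (f.factorization ℓ)) :
    (fixCount N M : ℂ) = localDensity N 1 (M 0 0 + M 1 1) f n := by
  sorry

/-- **T4-A TARGET** (M–L in total; = H4.4 ∘ [Popa's bookkeeping of the squarefree file with
`Squarefree N` replaced by `CuspSimple N` in `finsum_bw_wE_fixCount`, `finsum_bw_wH_fixCount`,
`bdryMap_heckeV`, `two_mul_cuspidalHeckeTrace_eq`] ∘ H4.6): the Eichler–Selberg identity on
`S₂(Γ₀(N))` for CUSP-SIMPLE `N` and `(n, N) = 1` — exactly the input shape of
`takahashi2001_brandtEigenLattice_rank_one_of_cuspidalHeckeTrace_eq` / k3-gen-2 `pizerTraceIdentityCoprime_of`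
at the Frey levels `M = 2^e m`, `M q` with `e ≤ 3`. -/
theorem cuspidalHeckeTrace_eq_geometricSide_of_cuspSimple {N : ℕ} [NeZero N] (hN : CuspSimple N)
    {n : ℕ} (hn : 0 < n) (hnN : n.Coprime N) :
    cuspidalHeckeTrace N 2 1 n = geometricSide N 1 2 n := by
  sorry

/-- Regime B (`16 ∣ N`, i.e. `4 ≤ e ≤ 8`): Popa's boundary step FAILS as typed (cusps of
`gcd(c, N/c) ∈ {4, 8, 16}` carry `χ₋₄, χ_{±8}`; `T_p` is not the scalar `1 + p` on `ℚ[cusps]`), so the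
GL₂ input stays the named fact, consumed in the coprime shape below (Cohen–Oesterlé 1977 /
Hijikata 1974, = `HeckeTraceFormulaGL2Level N 𝟙 2` restricted to `(n, N) = 1`). -/
theorem cuspidalHeckeTrace_eq_geometricSide_of_traceFormula {N : ℕ} [NeZero N]
    (hTF : HeckeTraceFormulaGL2Level N 1 2) {n : ℕ} (hn : 0 < n) :
    cuspidalHeckeTrace N 2 1 n = geometricSide N 1 2 n := by
  have hχ : (1 : DirichletCharacter ℂ N) (-1) = (-1 : ℂ) ^ (2 : ℤ) := by
    rw [MulChar.one_apply isUnit_one.neg, zpow_two]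
    norm_num
  exact hTF le_rfl hχ n hn

/-! ## §T5 — extremal split of T♭: square law (all data) ∧ optimal index (minimal datum) -/

/-- `i₀(w, g)` — verbatim k2 gen-2 `StubIdeas2G2.pairingGcd` (restated to keep this sketch
import-free of other sketches): the generator of the ideal of pairing values `⟨g, ℤ[Cls]⁰⟩`. -/
def pairingGcd {ι : Type*} [Fintype ι] (w : ι → ℕ) (g : ι → ℤ) : ℕ :=
  ((Finset.univ : Finset (ι × ι)).gcd fun p => (w p.1 : ℤ) * g p.1 - (w p.2 : ℤ) * g p.2).natAbs

/-- **T5a — THE SQUARE LAW (functorial half of T♭; NO optimality / minimality binder)**: for EVERY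
modular parametrisation datum `P'` of EVERY elliptic curve `W'` of conductor `M r` and every Brandt
setup whose `a(W')`-eigen-line is `ℤ g`:  `δ(P') · ord_r Δ_min(W') = m² · ξ_S` for some `m ≥ 1`
(`m = ` the index of `π'^*(1_{Φ_r(W')})` in `ℤ g`; adjunction `u_J(π^* x, y) = u_W(x, π_* y)`,
`π_* π^* = deg`, `u_W(1,1) = c_r`).  Consequences: `ξ_S ∣ δ' c_r'` with a SQUARE cofactor and
`ξ_S ≤ δ' c_r'` for every parametrised curve of conductor `M r` — auditable on all 578 + the
non-optimal members of the CoprimeProofs audit without any optimality determination.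
[Takahashi 2001, proof of Thm. 2.3, p. 80 (the displayed identity, valid for any `X₀(N) → E'`);
Conrad–Stein, Prop. 6.5 (adjunction)] -/
def takahashiSquareLaw_of_coprime : Prop :=
  ∀ (W : WeierstrassCurve ℚ) [W.IsElliptic] (M r : ℕ) [NeZero (M * r)],
    r.Prime → M.Coprime r → W.conductorNorm ℤ = M * r →
    ∀ (P : ModularParametrizationData W (M * r)) (S : Brandt.XiSetup M r)
      [Fintype (Brandt.ClassSet S.O)] (g : Brandt.ClassSet S.O → ℤ),
      g ≠ 0 → Brandt.eigenLattice (M * r) (Brandt.matrix S.O) (fun n => W.LFunction n) = ℤ ∙ g →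
      ∃ m : ℕ, 0 < m ∧
        P.modularDegree * (W.minimalDiscriminantNorm ℤ).factorization r =
          m ^ 2 * S.xi (fun n => W.LFunction n)

/-- **T5b — THE OPTIMAL INDEX (optimal half of T♭; the only place minimality enters)**: for the
conductor-minimal datum, the square-law integer `m` satisfies `m · i₀ = c_r`
(`π_* : X → Φ_r(E)` is ONTO for the optimal quotient, Takahashi Lemma 2.1–2.2, so
`i_r := [ℤ : π_*X]·… = c_r/m` generates the ideal `⟨g, X⟩ = i₀ ℤ`). -/
def takahashiOptimalIndex_of_coprime : Prop :=
  ∀ (W : WeierstrassCurve ℚ) [W.IsElliptic] (M r : ℕ) [NeZero (M * r)],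
    r.Prime → M.Coprime r → W.conductorNorm ℤ = M * r →
    ∀ P : ModularParametrizationData W (M * r),
      (∀ (W' : WeierstrassCurve ℚ) [W'.IsElliptic], W'.conductorNorm ℤ = M * r →
          ∀ P' : ModularParametrizationData W' (M * r),
          P'.f = P.f → P.modularDegree ≤ P'.modularDegree) →
      ∀ (S : Brandt.XiSetup M r) [Fintype (Brandt.ClassSet S.O)] (g : Brandt.ClassSet S.O → ℤ),
        g ≠ 0 → Brandt.eigenLattice (M * r) (Brandt.matrix S.O) (fun n => W.LFunction n) = ℤ ∙ g →
        ∀ m : ℕ, P.modularDegree * (W.minimalDiscriminantNorm ℤ).factorization r =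
            m ^ 2 * S.xi (fun n => W.LFunction n) →
          m * pairingGcd (Brandt.weight S.O) g = (W.minimalDiscriminantNorm ℤ).factorization r

/-- L5.1 (XS, PROVED): square law + optimal index ⇒ the pinned form `i₀ ∣ c ∧ δ i₀² = ξ c` of k2's T♭. -/
theorem pinned_of_squareLaw_of_index {δ ξ c m i : ℕ} (hsq : δ * c = m ^ 2 * ξ) (hmi : m * i = c)
    (hc : 0 < c) : i ∣ c ∧ δ * i ^ 2 = ξ * c := by
  refine ⟨⟨m, by rw [← hmi, mul_comm]⟩, ?_⟩
  have h : δ * c * i ^ 2 = ξ * c * c := by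
    rw [hsq, ← hmi]; ring
  have h' : (δ * i ^ 2) * c = (ξ * c) * c := by
    calc (δ * i ^ 2) * c = δ * c * i ^ 2 := by ring
      _ = ξ * c * c := h
      _ = (ξ * c) * c := by ring
  exact Nat.eq_of_mul_eq_mul_right hc h'

/-- L5.2 (XS, PROVED): conversely the pinned form + square law ⇒ the optimal index, when `ξ > 0`. -/
theorem index_of_pinned_of_squareLaw {δ ξ c m i : ℕ} (hsq : δ * c = m ^ 2 * ξ)
    (hpin : δ * i ^ 2 = ξ * c) (hξ : 0 < ξ) : m * i = c := by
  have h : (m * i) ^ 2 * ξ = c ^ 2 * ξ := by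
    have : δ * c * i ^ 2 = m ^ 2 * ξ * i ^ 2 := by rw [hsq]
    calc (m * i) ^ 2 * ξ = m ^ 2 * ξ * i ^ 2 := by ring
      _ = δ * c * i ^ 2 := this.symm
      _ = (δ * i ^ 2) * c := by ring
      _ = ξ * c * c := by rw [hpin]
      _ = c ^ 2 * ξ := by ring
  have h2 : (m * i) ^ 2 = c ^ 2 := Nat.eq_of_mul_eq_mul_right hξ h
  exact Nat.pow_left_injective two_ne_zero h2

/-- L5.3 (XS, PROVED): the square law alone bounds the congruence modulus by EVERY parametrised
degree: `ξ ≤ δ' · c_r'` (the optimality-free extreme; the route's inequality `δ ≤ ξ c_r` is the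
OTHER extreme and needs T5b: `m ≤ c_r`). -/
theorem xi_le_of_squareLaw {δ ξ c m : ℕ} (hsq : δ * c = m ^ 2 * ξ) (hm : 0 < m) : ξ ≤ δ * c := by
  rw [hsq]
  exact Nat.le_mul_of_pos_left ξ (pow_pos hm 2)

/-- L5.4 (XS, PROVED): square law + optimal index ⇒ the route's consumed inequality `δ ≤ ξ · c_r`
(`δ c = m² ξ`, `m ∣ c` ⇒ `δ = m ξ (c/m)⁻¹…`; precisely `δ · c = m² ξ ≤ (c ξ) · c` as `m ≤ c`). -/
theorem deg_le_of_squareLaw_of_index {δ ξ c m i : ℕ} (hsq : δ * c = m ^ 2 * ξ) (hmi : m * i = c)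
    (hc : 0 < c) : δ ≤ ξ * c := by
  have hi : 0 < i := Nat.pos_of_ne_zero fun h0 => by simp [h0] at hmi; omega
  have hm : m ≤ c := by rw [← hmi]; exact Nat.le_mul_of_pos_right m hi
  have h : δ * c ≤ (ξ * c) * c := by
    calc δ * c = m ^ 2 * ξ := hsq
      _ = m * m * ξ := by ring
      _ ≤ c * c * ξ := by gcongr
      _ = (ξ * c) * c := by ring
  exact Nat.le_of_mul_le_mul_right h hc

/-- (verbatim k2 gen-2 `pairingGcd_dvd_sum`, PROVED) `i₀` divides every pairing value on `ℤ[Cls]⁰`. -/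
theorem pairingGcd_dvd_sum {ι : Type*} [Fintype ι] (w : ι → ℕ) (g y : ι → ℤ) (hy : ∑ i, y i = 0) :
    (pairingGcd w g : ℤ) ∣ ∑ i, (w i : ℤ) * g i * y i := by
  classical
  unfold pairingGcd
  rw [Int.natAbs_dvd]
  rcases isEmpty_or_nonempty ι with hι | ⟨⟨b⟩⟩
  · simp
  · have key : ∑ i, (w i : ℤ) * g i * y i = ∑ i, ((w i : ℤ) * g i - (w b : ℤ) * g b) * y i := by
      have h : ∑ i, ((w i : ℤ) * g i - (w b : ℤ) * g b) * y i
          = ∑ i, (w i : ℤ) * g i * y i - (w b : ℤ) * g b * ∑ i, y i := by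
        rw [Finset.mul_sum, ← Finset.sum_sub_distrib]
        exact Finset.sum_congr rfl fun i _ => by ring
      rw [h, hy, mul_zero, sub_zero]
    rw [key]
    exact Finset.dvd_sum fun i _ =>
      dvd_mul_of_dvd_left (Finset.gcd_dvd (Finset.mem_univ (i, b))) _

/-- (verbatim k2 gen-2 `pairingGcd_dvd_xi`, PROVED) `i₀ ∣ ξ_S`. -/
theorem pairingGcd_dvd_xi {M r : ℕ} (S : Brandt.XiSetup M r) [Fintype (Brandt.ClassSet S.O)]
    (W : WeierstrassCurve ℚ) [W.IsElliptic] {g : Brandt.ClassSet S.O → ℤ} (hg : g ≠ 0)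
    (hL : Brandt.eigenLattice (M * r) (Brandt.matrix S.O) (fun n => W.LFunction n) = ℤ ∙ g) :
    pairingGcd (Brandt.weight S.O) g ∣ S.xi (fun n => W.LFunction n) := by
  have h0 : ∑ i, g i = 0 := S.sum_eq_zero_of_eigenLattice_lFunction_eq_span W hL
  have h1 := pairingGcd_dvd_sum (Brandt.weight S.O) g g h0
  have h2 : S.xi (fun n => W.LFunction n) = ∑ i, Brandt.weight S.O i * (g i).natAbs ^ 2 :=
    xi_lFunction_eq_sum W S hg hL
  have h3 : ((S.xi (fun n => W.LFunction n) : ℕ) : ℤ) =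
      ∑ i, (Brandt.weight S.O i : ℤ) * g i * g i := by
    rw [h2]
    simp only [Nat.cast_sum, Nat.cast_mul, Nat.cast_pow, Int.natCast_natAbs, sq_abs]
    exact Finset.sum_congr rfl fun i _ => by ring
  rw [← h3] at h1
  exact Int.natCast_dvd_natCast.mp h1

/-- (verbatim k2 gen-2, PROVED) `c_r = ord_r Δ_min(W) > 0` for `r ∣ N_W`. -/
theorem factorization_minimalDiscriminantNorm_pos {W : WeierstrassCurve ℚ} [W.IsElliptic]
    {M r : ℕ} (hr : r.Prime) (hN : W.conductorNorm ℤ = M * r) :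
    0 < (W.minimalDiscriminantNorm ℤ).factorization r := by
  have hfin := WeierstrassCurve.finite_setOf_ordMinimalDiscriminant_ne_zero_holds (A := ℤ) W
  have hdvd : W.conductorNorm ℤ ∣ W.minimalDiscriminantNorm ℤ :=
    W.conductorNorm_dvd_minimalDiscriminantNorm hfin
  have hpos : 0 < W.minimalDiscriminantNorm ℤ := W.minimalDiscriminantNorm_pos_holds
  have hrd : r ∣ W.minimalDiscriminantNorm ℤ := dvd_trans ⟨M, by rw [hN, mul_comm]⟩ hdvd
  exact hr.factorization_pos_of_dvd hpos.ne' hrd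

/-- **L5.5 — ASSEMBLY (S, PROVED modulo the two named halves and rank one)**:
rank one ∧ square law ∧ optimal index ⇒ the stub (via k2's pinned shape). -/
theorem stub_of_squareLaw_of_index
    (h1 : ∀ (W : WeierstrassCurve ℚ) [W.IsElliptic] (M r : ℕ) [NeZero (M * r)],
      r.Prime → M.Coprime r → W.conductorNorm ℤ = M * r →
      ∀ (_P : ModularParametrizationData W (M * r)) (S : Brandt.XiSetup M r) [Fintype (Brandt.ClassSet S.O)],
        Module.finrank ℤ (Brandt.eigenLattice (M * r) (Brandt.matrix S.O) (fun n => W.LFunction n)) = 1)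
    (h2 : takahashiSquareLaw_of_coprime) (h3 : takahashiOptimalIndex_of_coprime) :
    takahashi2001_thm_2_3_of_coprime := by
  intro W _ M r _ hr hcop hN P hmin S
  classical
  haveI : Fintype (Brandt.ClassSet S.O) := Fintype.ofFinite _
  obtain ⟨g, hg, hL⟩ :=
    Takahashi2001.exists_eq_span_of_finrank_eq_one (h1 W M r hr hcop hN P S)
  obtain ⟨m, hm, hsq⟩ := h2 W M r hr hcop hN P S g hg hL
  have hmi := h3 W M r hr hcop hN P hmin S g hg hL m hsq
  have hc := factorization_minimalDiscriminantNorm_pos (W := W) hr hN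
  set c := (W.minimalDiscriminantNorm ℤ).factorization r with hc_def
  set i₀ := pairingGcd (Brandt.weight S.O) g with hi_def
  have hi : 0 < i₀ := Nat.pos_of_ne_zero fun h0 => by
    rw [h0, mul_zero] at hmi; omega
  refine ⟨i₀, m, hi, by rw [mul_comm]; exact hmi, pairingGcd_dvd_xi S W hg hL, ?_⟩
  -- `δ c = m² ξ`, `c = m i₀`, `m > 0` ⇒ `δ i₀ = ξ m`
  have h : (P.modularDegree * i₀) * m = (S.xi (fun n => W.LFunction n) * m) * m := by
    calc (P.modularDegree * i₀) * m = P.modularDegree * (m * i₀) := by ring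
      _ = P.modularDegree * c := by rw [hmi]
      _ = m ^ 2 * S.xi (fun n => W.LFunction n) := hsq
      _ = (S.xi (fun n => W.LFunction n) * m) * m := by ring
  exact Nat.eq_of_mul_eq_mul_right hm h

end Summit.ABC.ABC.Cruxes.DefiniteRTControlPrime.StubIdeas3g3

end
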